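import Mathlib
import Literature.MeasureTheory.Integral.HausdorffMomentTheorem
import HarnessLib

/-!
# Bernstein's theorem: bounded completely monotone functions on `(0,∞)` are Laplace transforms of
# finite positive measures on `[0,∞)`

**Theorem** (S. N. Bernstein 1928; Widder, *The Laplace Transform* (1941), Ch. IV §§2–4 and Thm. 12a;
Berg–Christensen–Ressel 1984, Ch. 4, Thm. 6.13).  Let `f : ℝ → ℝ` be continuous on `(0,∞)`, bounded above
there, and completely monotone in the DIFFERENCE sense, `∑_{i ≤ k} (-1)^i C(k,i) f(t + i h) ≥ 0` for all
`k ∈ ℕ`, `h > 0`, `t > 0` (written out; no definition is introduced).  Then there is a finite positive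
measure `μ` on `ℝ` carried by `[0,∞)` with `f t = ∫ e^{-t s} dμ(s)` for every `t > 0` and `f(0+) = μ(ℝ)`
(`exists_measure_laplace_eq_of_alternating`).  The derivative form (`f` smooth, `(-1)^k f^{(k)} ≥ 0`) is in
the companion file `BernsteinCompletelyMonotoneDeriv.lean`.

Proof (Widder's route through Hausdorff's moment theorem, in the tree as `hausdorffMoment_of_alternating`):
`f` is nonnegative and non-increasing, so `L = f(0+)` exists; for a mesh `h > 0` the sequence `a 0 = L`,
`a n = f(n h)` is completely monotone (its alternating differences are limits `t → 0+` of the hypothesis),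
hence `a n = ∫ xⁿ dμ_h` with `μ_h` finite on `[0,1]`; the meshes `1` and `1/q` are related by the push-forward
`x ↦ x^q` (determinacy of the Hausdorff moment problem = Weierstrass), so `f r = ∫ x^r dμ_1` for positive
rationals `r`, then for all `t > 0` by continuity; `s = -log x` turns `μ_1|_{(0,1]}` into the representing
measure, and dominated convergence identifies `f(0+)` with its mass.  Mathlib has no completely monotone
functions / Bernstein–Widder theory; the tree so far had the measure-free consequences (`SemigroupPosDef*`,
`LittleBernstein*`, `BernsteinWidderHalfPlane`), the discrete theorem (`HausdorffMomentTheorem`) and the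
uniqueness of the representing measure (`LaplaceTransformUnique`).

## References
* S. Bernstein, *Sur les fonctions absolument monotones*, Acta Math. 52 (1928) 1–66.
* D. V. Widder, *The Laplace Transform*, Princeton Univ. Press (1941), Ch. IV §§2–4, Thm. 12a. [Widder1941]
* C. Berg, J. P. R. Christensen, P. Ressel, *Harmonic Analysis on Semigroups*, GTM 100 (1984), Ch. 4,
  Prop. 6.11, Thm. 6.13. [BergChristensenRessel1984]
-/

noncomputable section

open MeasureTheory Set Filter Topology

namespace Literature.MeasureTheory.Integral

namespace BernsteinCompletelyMonotone

variable {f : ℝ → ℝ}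

/-! ## 1. Elementary consequences of the alternating differences -/

/-- `k = 0`: a completely monotone function is nonnegative. [cite: Widder1941, Ch. IV §2] -/
theorem nonneg (hCM : ∀ (k : ℕ) (h t : ℝ), 0 < h → 0 < t →
      0 ≤ ∑ i ∈ Finset.range (k + 1), (-1 : ℝ) ^ i * (k.choose i : ℝ) * f (t + i * h))
    {t : ℝ} (ht : 0 < t) : 0 ≤ f t := by
  have h := hCM 0 1 t one_pos ht
  simpa using h

/-- `k = 1`: a completely monotone function is non-increasing on `(0,∞)`. [cite: Widder1941, Ch. IV §2] -/
theorem antitoneOn (hCM : ∀ (k : ℕ) (h t : ℝ), 0 < h → 0 < t →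
      0 ≤ ∑ i ∈ Finset.range (k + 1), (-1 : ℝ) ^ i * (k.choose i : ℝ) * f (t + i * h)) :
    AntitoneOn f (Ioi 0) := by
  intro s hs t _ hst
  rcases hst.eq_or_lt with rfl | hlt
  · exact le_rfl
  · have h := hCM 1 (t - s) s (sub_pos.2 hlt) hs
    simp [Finset.sum_range_succ] at h
    linarith

/-- The right limit `f(0+)` exists: `f → sSup (f '' (0,∞))` as `t → 0+` (a bounded completely monotone function is
non-increasing and bounded). [cite: Widder1941, Ch. IV §2] -/
theorem tendsto_sSup (hCM : ∀ (k : ℕ) (h t : ℝ), 0 < h → 0 < t →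
      0 ≤ ∑ i ∈ Finset.range (k + 1), (-1 : ℝ) ^ i * (k.choose i : ℝ) * f (t + i * h))
    (hbdd : ∃ C : ℝ, ∀ t, 0 < t → f t ≤ C) :
    Tendsto f (𝓝[>] 0) (𝓝 (sSup (f '' Ioi 0))) := by
  refine (antitoneOn hCM).tendsto_nhdsGT ?_
  obtain ⟨C, hC⟩ := hbdd
  refine ⟨C, ?_⟩
  rintro _ ⟨t, ht, rfl⟩
  exact hC t ht

/-! ## 2. The completely monotone sequences `L, f(h), f(2h), …` -/

/-- For a mesh `h > 0`, the sequence `a 0 = f(0+)`, `a n = f(n h)` is completely monotone: its alternating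
differences are the limits as `t → 0+` of the alternating differences of `f` at `t + n h`. [cite: Widder1941, Ch. IV §3] -/
theorem seq_alternating (hcont : ContinuousOn f (Ioi 0))
    (hCM : ∀ (k : ℕ) (h t : ℝ), 0 < h → 0 < t →
      0 ≤ ∑ i ∈ Finset.range (k + 1), (-1 : ℝ) ^ i * (k.choose i : ℝ) * f (t + i * h))
    {L : ℝ} (hL : Tendsto f (𝓝[>] 0) (𝓝 L)) {h : ℝ} (hh : 0 < h) (n k : ℕ) :
    0 ≤ ∑ i ∈ Finset.range (k + 1), (-1 : ℝ) ^ i * (k.choose i : ℝ) *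
      (fun m : ℕ => if m = 0 then L else f (m * h)) (n + i) := by
  have hlim : ∀ m : ℕ, Tendsto (fun t : ℝ => f (t + m * h)) (𝓝[>] 0)
      (𝓝 ((fun m : ℕ => if m = 0 then L else f (m * h)) m)) := by
    intro m
    rcases Nat.eq_zero_or_pos m with rfl | hm
    · simpa using hL
    · have hm' : (m : ℝ) * h ≠ 0 := by positivity
      have hpos : 0 < (m : ℝ) * h := by positivity
      simp only [Nat.pos_iff_ne_zero.mp hm, if_false]
      have hca : ContinuousAt f (m * h) := hcont.continuousAt (Ioi_mem_nhds hpos)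
      have h1 : Tendsto (fun t : ℝ => t + m * h) (𝓝[>] 0) (𝓝 (m * h)) := by
        have : Tendsto (fun t : ℝ => t + m * h) (𝓝 0) (𝓝 (0 + m * h)) :=
          tendsto_id.add tendsto_const_nhds
        rw [zero_add] at this
        exact this.mono_left nhdsWithin_le_nhds
      exact hca.tendsto.comp h1
  have hsum : Tendsto (fun t : ℝ => ∑ i ∈ Finset.range (k + 1),
      (-1 : ℝ) ^ i * (k.choose i : ℝ) * f (t + ((n + i : ℕ) : ℝ) * h)) (𝓝[>] 0)
      (𝓝 (∑ i ∈ Finset.range (k + 1), (-1 : ℝ) ^ i * (k.choose i : ℝ) *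
        (fun m : ℕ => if m = 0 then L else f (m * h)) (n + i))) :=
    tendsto_finsetSum _ fun i _ => (hlim (n + i)).const_mul _
  refine ge_of_tendsto hsum ?_
  filter_upwards [self_mem_nhdsWithin] with t ht
  have ht' : 0 < t + n * h := by
    have : (0 : ℝ) ≤ n * h := by positivity
    linarith [show (0 : ℝ) < t from ht]
  have := hCM k h (t + n * h) hh ht'
  refine this.trans_eq (Finset.sum_congr rfl fun i _ => ?_)
  push_cast
  ring_nf

/-- Hausdorff's theorem applied to the mesh-`h` sequence: a finite measure `μ_h` on `[0,1]` with
`∫ xⁿ dμ_h = f(n h)` (`n ≥ 1`) and `μ_h(ℝ) = f(0+)`. [cite: Widder1941, Ch. IV §3] -/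
theorem exists_hausdorff_measure (hcont : ContinuousOn f (Ioi 0))
    (hCM : ∀ (k : ℕ) (h t : ℝ), 0 < h → 0 < t →
      0 ≤ ∑ i ∈ Finset.range (k + 1), (-1 : ℝ) ^ i * (k.choose i : ℝ) * f (t + i * h))
    {L : ℝ} (hL : Tendsto f (𝓝[>] 0) (𝓝 L)) {h : ℝ} (hh : 0 < h) :
    ∃ μ : Measure ℝ, IsFiniteMeasure μ ∧ μ (Icc (0 : ℝ) 1)ᶜ = 0 ∧
      (∀ n : ℕ, (fun m : ℕ => if m = 0 then L else f (m * h)) n = ∫ x, x ^ n ∂μ) :=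
  hausdorffMoment_of_alternating _ (seq_alternating hcont hCM hL hh)

/-! ## 3. Consistency of the meshes `1` and `1/q`: `f r = ∫ x^r dμ₁` for positive rationals `r` -/

/-- A function continuous on `[0,1]` is integrable against a finite measure carried by `[0,1]`. [folklore] -/
private theorem integrable_of_continuousOn_Icc {ν : Measure ℝ} [IsFiniteMeasure ν] (hν : ν (Icc (0 : ℝ) 1)ᶜ = 0)
    {g : ℝ → ℝ} (hg : ContinuousOn g (Icc 0 1)) (hgm : AEStronglyMeasurable g ν) : Integrable g ν := by
  obtain ⟨B, hB⟩ := isCompact_Icc.exists_bound_of_continuousOn hg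
  refine Integrable.mono' (integrable_const B) hgm ?_
  filter_upwards [mem_ae_iff.2 hν] with x hx using hB x hx

/-- **Determinacy of the Hausdorff moment problem, integral form**: two finite measures on `[0,1]` with the
same moments integrate every function continuous on `[0,1]` equally (Weierstrass approximation).
[cite: BergChristensenRessel1984, Ch. 4 Prop. 6.11] -/
theorem integral_eq_of_moments_eq {P Q : Measure ℝ} [IsFiniteMeasure P] [IsFiniteMeasure Q]
    (hP : P (Icc (0 : ℝ) 1)ᶜ = 0) (hQ : Q (Icc (0 : ℝ) 1)ᶜ = 0)
    (hmom : ∀ n : ℕ, ∫ x, x ^ n ∂P = ∫ x, x ^ n ∂Q) {g : ℝ → ℝ} (hg : Continuous g) :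
    ∫ x, g x ∂P = ∫ x, g x ∂Q := by
  have haeP : ∀ᵐ x ∂P, x ∈ Icc (0 : ℝ) 1 := mem_ae_iff.2 hP
  have haeQ : ∀ᵐ x ∂Q, x ∈ Icc (0 : ℝ) 1 := mem_ae_iff.2 hQ
  have hpow : ∀ (R : Measure ℝ) [IsFiniteMeasure R], R (Icc (0 : ℝ) 1)ᶜ = 0 →
      ∀ n : ℕ, Integrable (fun x : ℝ => x ^ n) R := fun R _ hR n =>
    integrable_of_continuousOn_Icc hR (continuous_pow n).continuousOn (continuous_pow n).aestronglyMeasurable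
  have hpoly : ∀ p : Polynomial ℝ, ∫ x, p.eval x ∂P = ∫ x, p.eval x ∂Q := by
    intro p
    simp_rw [Polynomial.eval_eq_sum_range]
    rw [integral_finsetSum _ fun i _ => (hpow P hP i).const_mul _,
      integral_finsetSum _ fun i _ => (hpow Q hQ i).const_mul _]
    refine Finset.sum_congr rfl fun i _ => ?_
    rw [integral_const_mul, integral_const_mul, hmom i]
  have hgP : Integrable g P := integrable_of_continuousOn_Icc hP hg.continuousOn hg.aestronglyMeasurable
  have hgQ : Integrable g Q := integrable_of_continuousOn_Icc hQ hg.continuousOn hg.aestronglyMeasurable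
  have key : ∀ ε : ℝ, 0 < ε → |∫ x, g x ∂P - ∫ x, g x ∂Q| ≤ ε * (P.real univ + Q.real univ) := by
    intro ε hε
    obtain ⟨p, hp⟩ := exists_polynomial_near_of_continuousOn 0 1 g hg.continuousOn ε hε
    have hpP : Integrable (fun x => p.eval x) P :=
      integrable_of_continuousOn_Icc hP p.continuous.continuousOn p.continuous.aestronglyMeasurable
    have hpQ : Integrable (fun x => p.eval x) Q :=
      integrable_of_continuousOn_Icc hQ p.continuous.continuousOn p.continuous.aestronglyMeasurable
    have e1 : ∫ x, g x ∂P - ∫ x, g x ∂Q = (∫ x, (g x - p.eval x) ∂P) - ∫ x, (g x - p.eval x) ∂Q := by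
      rw [integral_sub hgP hpP, integral_sub hgQ hpQ, hpoly p]; ring
    have bP : ‖∫ x, (g x - p.eval x) ∂P‖ ≤ ε * P.real univ := by
      refine norm_integral_le_of_norm_le_const ?_
      filter_upwards [haeP] with x hx
      rw [Real.norm_eq_abs, abs_sub_comm]
      exact (hp x hx).le
    have bQ : ‖∫ x, (g x - p.eval x) ∂Q‖ ≤ ε * Q.real univ := by
      refine norm_integral_le_of_norm_le_const ?_
      filter_upwards [haeQ] with x hx
      rw [Real.norm_eq_abs, abs_sub_comm]
      exact (hp x hx).le
    rw [Real.norm_eq_abs] at bP bQ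
    rw [e1]
    calc |(∫ x, (g x - p.eval x) ∂P) - ∫ x, (g x - p.eval x) ∂Q|
        ≤ |∫ x, (g x - p.eval x) ∂P| + |∫ x, (g x - p.eval x) ∂Q| := abs_sub _ _
      _ ≤ ε * P.real univ + ε * Q.real univ := add_le_add bP bQ
      _ = ε * (P.real univ + Q.real univ) := by ring
  refine eq_of_abs_sub_eq_zero (le_antisymm ?_ (abs_nonneg _))
  by_contra hcon
  push Not at hcon
  have h := key (|∫ x, g x ∂P - ∫ x, g x ∂Q| / (2 * (P.real univ + Q.real univ + 1))) (by positivity)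
  rw [div_mul_eq_mul_div, le_div_iff₀ (by positivity)] at h
  nlinarith [abs_nonneg (∫ x, g x ∂P - ∫ x, g x ∂Q), show 0 ≤ P.real univ + Q.real univ by positivity]

/-- Push-forward by `x ↦ x^q` of a finite measure on `[0,1]` is again carried by `[0,1]`. [folklore] -/
private theorem map_pow_Icc_compl {ν : Measure ℝ} (hν : ν (Icc (0 : ℝ) 1)ᶜ = 0) (q : ℕ) :
    (ν.map fun x : ℝ => x ^ q) (Icc (0 : ℝ) 1)ᶜ = 0 := by
  have hmeas : Measurable fun x : ℝ => x ^ q := by fun_prop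
  rw [Measure.map_apply hmeas (measurableSet_Icc.compl)]
  refine measure_mono_null (fun x hx => ?_) hν
  intro hx'
  exact hx ⟨pow_nonneg hx'.1 q, pow_le_one₀ hx'.1 hx'.2⟩

/-- The key identity: if `μ₁` and `μ'` are the Hausdorff measures of the meshes `1` and `1/q`, then
`(x ↦ x^q)_* μ' = μ₁` (both have the moments `f(n)`), hence `f (p/q) = ∫ x^{p/q} dμ₁` for `p ≥ 1`.
[cite: Widder1941, Ch. IV §4] -/
theorem eq_integral_rpow_of_rat {L : ℝ} {μ μ' : Measure ℝ} [IsFiniteMeasure μ] [IsFiniteMeasure μ']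
    (hμ : μ (Icc (0 : ℝ) 1)ᶜ = 0) (hμ' : μ' (Icc (0 : ℝ) 1)ᶜ = 0)
    (hmom : ∀ n : ℕ, (fun m : ℕ => if m = 0 then L else f (m * 1)) n = ∫ x, x ^ n ∂μ)
    {q : ℕ} (hq : 0 < q)
    (hmom' : ∀ n : ℕ, (fun m : ℕ => if m = 0 then L else f (m * (1 / (q : ℝ)))) n = ∫ x, x ^ n ∂μ')
    {p : ℕ} (hp : 0 < p) :
    f ((p : ℝ) / q) = ∫ x, x ^ ((p : ℝ) / q) ∂μ := by
  have hq' : (q : ℝ) ≠ 0 := by exact_mod_cast hq.ne'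
  set π : Measure ℝ := μ'.map fun x : ℝ => x ^ q with hπ_def
  have hmeas : Measurable fun x : ℝ => x ^ q := by fun_prop
  haveI : IsFiniteMeasure π := Measure.isFiniteMeasure_map μ' _
  have hπ : π (Icc (0 : ℝ) 1)ᶜ = 0 := map_pow_Icc_compl hμ' q
  have hmomπ : ∀ n : ℕ, ∫ y, y ^ n ∂π = ∫ y, y ^ n ∂μ := by
    intro n
    rw [hπ_def, integral_map hmeas.aemeasurable (continuous_pow n).aestronglyMeasurable]
    simp only [← pow_mul]
    rw [← hmom' (q * n), ← hmom n]
    rcases Nat.eq_zero_or_pos n with rfl | hn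
    · simp
    · have hqn : q * n ≠ 0 := Nat.mul_ne_zero hq.ne' hn.ne'
      simp only [hqn, hn.ne', if_false]
      congr 1
      push_cast
      field_simp
  have hπμ : ∫ y, y ^ ((p : ℝ) / q) ∂π = ∫ y, y ^ ((p : ℝ) / q) ∂μ :=
    integral_eq_of_moments_eq hπ hμ hmomπ (Real.continuous_rpow_const (by positivity))
  have h1 : f ((p : ℝ) / q) = ∫ x, x ^ p ∂μ' := by
    have := hmom' p
    simp only [hp.ne', if_false] at this
    rw [← this]
    congr 1
    field_simp
  have h2 : ∫ x, x ^ p ∂μ' = ∫ x, (x ^ q) ^ ((p : ℝ) / q) ∂μ' := by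
    refine integral_congr_ae ?_
    have hae : ∀ᵐ x ∂μ', x ∈ Icc (0 : ℝ) 1 := mem_ae_iff.2 hμ'
    filter_upwards [hae] with x hx
    rw [← Real.rpow_natCast x p, ← Real.rpow_natCast x q, ← Real.rpow_mul hx.1]
    congr 1
    field_simp
  have h3 : ∫ x, (x ^ q) ^ ((p : ℝ) / q) ∂μ' = ∫ y, y ^ ((p : ℝ) / q) ∂π := by
    rw [hπ_def, integral_map hmeas.aemeasurable]
    exact (Real.continuous_rpow_const (by positivity)).aestronglyMeasurable
  rw [h1, h2, h3, hπμ]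

/-! ## 4. The function `t ↦ ∫ x^t dμ₁` and the passage from rationals to reals -/

/-- `t ↦ ∫ x^t dμ` is continuous on `(0,∞)` for a finite measure on `[0,1]` (dominated by `1`). [folklore] -/
private theorem continuousOn_integral_rpow {μ : Measure ℝ} [IsFiniteMeasure μ] (hμ : μ (Icc (0 : ℝ) 1)ᶜ = 0) :
    ContinuousOn (fun t : ℝ => ∫ x, x ^ t ∂μ) (Ioi 0) := by
  have hae : ∀ᵐ x ∂μ, x ∈ Icc (0 : ℝ) 1 := mem_ae_iff.2 hμ
  refine continuousOn_of_dominated (bound := fun _ => (1 : ℝ)) ?_ ?_ (integrable_const _) ?_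
  · intro t ht
    exact (Real.continuous_rpow_const (le_of_lt ht)).aestronglyMeasurable
  · intro t ht
    filter_upwards [hae] with x hx
    rw [Real.norm_eq_abs, abs_of_nonneg (Real.rpow_nonneg hx.1 _)]
    exact Real.rpow_le_one hx.1 hx.2 (le_of_lt ht)
  · filter_upwards [hae] with x hx
    rcases hx.1.eq_or_lt with rfl | hxpos
    · refine (continuousOn_const (c := (0 : ℝ))).congr fun t ht => ?_
      exact Real.zero_rpow (ne_of_gt ht)
    · exact fun t _ => (Real.continuousAt_const_rpow hxpos.ne').continuousWithinAt

/-- From the rationals to the reals: two functions continuous on `(0,∞)` that agree at all positive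
rationals agree on `(0,∞)`. [folklore] -/
private theorem eqOn_Ioi_of_rat {g₁ g₂ : ℝ → ℝ} (h₁ : ContinuousOn g₁ (Ioi 0)) (h₂ : ContinuousOn g₂ (Ioi 0))
    (h : ∀ p q : ℕ, 0 < p → 0 < q → g₁ ((p : ℝ) / q) = g₂ ((p : ℝ) / q)) : EqOn g₁ g₂ (Ioi 0) := by
  set S : Set ℝ := {t : ℝ | ∃ p q : ℕ, 0 < p ∧ 0 < q ∧ t = (p : ℝ) / q} with hS
  have hSsub : S ⊆ Ioi 0 := by
    rintro _ ⟨p, q, hp, hq, rfl⟩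
    have hp' : (0 : ℝ) < p := Nat.cast_pos.2 hp
    have hq' : (0 : ℝ) < q := Nat.cast_pos.2 hq
    exact div_pos hp' hq'
  have hEq : EqOn g₁ g₂ S := by
    rintro _ ⟨p, q, hp, hq, rfl⟩
    exact h p q hp hq
  refine hEq.of_subset_closure h₁ h₂ hSsub ?_
  -- `(0,∞) ⊆ closure S`: every `t > 0` is a limit of positive rationals
  intro t ht
  rw [Metric.mem_closure_iff]
  intro ε hε
  obtain ⟨r, hr, hr'⟩ := exists_rat_btwn (show max (t - ε / 2) (t / 2) < t by
    have : (0 : ℝ) < t := ht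
    rw [max_lt_iff]; constructor <;> linarith)
  rw [max_lt_iff] at hr
  have hrpos : (0 : ℝ) < r := by linarith [show (0 : ℝ) < t from ht]
  have hrpos' : 0 < r := by exact_mod_cast hrpos
  refine ⟨r, ⟨r.num.toNat, r.den, ?_, r.den_pos, ?_⟩, ?_⟩
  · have := Rat.num_pos.2 hrpos'
    omega
  · have hnum : ((r.num.toNat : ℕ) : ℝ) = (r.num : ℝ) := by
      have : (r.num.toNat : ℤ) = r.num := Int.toNat_of_nonneg (Rat.num_pos.2 hrpos').le
      exact_mod_cast this
    rw [hnum]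
    exact_mod_cast (Rat.num_div_den r).symm
  · rw [Real.dist_eq, abs_of_pos (by linarith)]
    linarith

end BernsteinCompletelyMonotone

open BernsteinCompletelyMonotone

/-! ## 5. Bernstein's theorem -/

/-- **Bernstein's theorem (difference form).**  A function continuous and bounded above on `(0,∞)` whose
iterated differences alternate, `∑_{i ≤ k} (-1)^i C(k,i) f(t + i h) ≥ 0` (`k ∈ ℕ`, `h, t > 0`), is the
Laplace transform of a finite positive measure on `[0,∞)`: `f t = ∫ e^{-t s} dμ(s)` for `t > 0`, and
`f(0+) = μ(ℝ)`. [cite: Widder1941, Ch. IV Thm. 12a] [cite: BergChristensenRessel1984, Ch. 4 Thm. 6.13] -/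
theorem exists_measure_laplace_eq_of_alternating (f : ℝ → ℝ) (hcont : ContinuousOn f (Ioi 0))
    (hCM : ∀ (k : ℕ) (h t : ℝ), 0 < h → 0 < t →
      0 ≤ ∑ i ∈ Finset.range (k + 1), (-1 : ℝ) ^ i * (k.choose i : ℝ) * f (t + i * h))
    (hbdd : ∃ C : ℝ, ∀ t, 0 < t → f t ≤ C) :
    ∃ μ : Measure ℝ, IsFiniteMeasure μ ∧ μ (Iio 0) = 0 ∧
      (∀ t : ℝ, 0 < t → f t = ∫ s, Real.exp (-(t * s)) ∂μ) ∧
      Tendsto f (𝓝[>] 0) (𝓝 (μ.real univ)) := by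
  set L : ℝ := sSup (f '' Ioi 0) with hL_def
  have hL : Tendsto f (𝓝[>] 0) (𝓝 L) := tendsto_sSup hCM hbdd
  -- the Hausdorff measure of mesh `1`
  obtain ⟨μ₁, hfin₁, hμ₁, hmom₁⟩ := exists_hausdorff_measure hcont hCM hL one_pos
  haveI := hfin₁
  have hmom₁' : ∀ n : ℕ, (fun m : ℕ => if m = 0 then L else f (m * 1)) n = ∫ x, x ^ n ∂μ₁ := by
    simpa using hmom₁
  -- `f = ∫ x^· dμ₁` at positive rationals, then on `(0,∞)`
  have hrat : ∀ p q : ℕ, 0 < p → 0 < q → f ((p : ℝ) / q) = ∫ x, x ^ ((p : ℝ) / q) ∂μ₁ := by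
    intro p q hp hq
    obtain ⟨μ', hfin', hμ', hmom'⟩ :=
      exists_hausdorff_measure hcont hCM hL (h := 1 / (q : ℝ)) (by positivity)
    haveI := hfin'
    exact eq_integral_rpow_of_rat hμ₁ hμ' hmom₁' hq hmom' hp
  have hreal : EqOn f (fun t : ℝ => ∫ x, x ^ t ∂μ₁) (Ioi 0) :=
    eqOn_Ioi_of_rat hcont (continuousOn_integral_rpow hμ₁) hrat
  -- the representing measure: `s = -log x` on `(0,1]`
  have hae₁ : ∀ᵐ x ∂μ₁, x ∈ Icc (0 : ℝ) 1 := mem_ae_iff.2 hμ₁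
  have hψ : Measurable fun x : ℝ => -Real.log x := Real.measurable_log.neg
  set μ : Measure ℝ := (μ₁.restrict (Ioc 0 1)).map fun x : ℝ => -Real.log x with hμ_def
  haveI : IsFiniteMeasure μ := Measure.isFiniteMeasure_map _ _
  -- `∫ x^t dμ₁ = ∫_{(0,1]} x^t dμ₁ = ∫ e^{-ts} dμ`
  have hrepr : ∀ t : ℝ, 0 < t → ∫ x, x ^ t ∂μ₁ = ∫ s, Real.exp (-(t * s)) ∂μ := by
    intro t ht
    have hstep1 : ∫ x, x ^ t ∂μ₁ = ∫ x in Ioc 0 1, x ^ t ∂μ₁ := by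
      rw [← integral_indicator measurableSet_Ioc]
      refine integral_congr_ae ?_
      filter_upwards [hae₁] with x hx
      by_cases hx0 : 0 < x
      · rw [indicator_of_mem (show x ∈ Ioc (0 : ℝ) 1 from ⟨hx0, hx.2⟩)]
      · have : x = 0 := le_antisymm (not_lt.1 hx0) hx.1
        rw [this, indicator_of_notMem (by simp), Real.zero_rpow ht.ne']
    have hstep2 : ∫ s, Real.exp (-(t * s)) ∂μ = ∫ x in Ioc 0 1, Real.exp (-(t * -Real.log x)) ∂μ₁ := by
      rw [hμ_def, integral_map hψ.aemeasurable]
      exact (by fun_prop : Continuous fun s : ℝ => Real.exp (-(t * s))).aestronglyMeasurable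
    rw [hstep1, hstep2]
    refine setIntegral_congr_fun measurableSet_Ioc fun x hx => ?_
    rw [Real.rpow_def_of_pos hx.1]
    congr 1
    ring
  refine ⟨μ, inferInstance, ?_, fun t ht => (hreal ht).trans (hrepr t ht), ?_⟩
  · -- carried by `[0,∞)`
    rw [hμ_def, Measure.map_apply hψ measurableSet_Iio, Measure.restrict_apply (hψ measurableSet_Iio)]
    have : (fun x : ℝ => -Real.log x) ⁻¹' Iio 0 ∩ Ioc (0 : ℝ) 1 = ∅ := by
      ext x
      simp only [mem_inter_iff, mem_preimage, mem_Iio, mem_Ioc, mem_empty_iff_false, iff_false, not_and,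
        neg_lt_zero, not_le]
      intro hlog hx0
      contrapose! hlog
      exact Real.log_nonpos hx0.le hlog
    rw [this, measure_empty]
  · -- `f(0+) = μ(ℝ) = μ₁((0,1])` by dominated convergence
    have hmass : μ.real univ = μ₁.real (Ioc 0 1) := by
      rw [measureReal_def, measureReal_def, hμ_def, Measure.map_apply hψ MeasurableSet.univ, preimage_univ,
        Measure.restrict_apply MeasurableSet.univ, univ_inter]
    rw [hmass]
    have hlim : Tendsto (fun t : ℝ => ∫ x in Ioc 0 1, x ^ t ∂μ₁) (𝓝[>] 0) (𝓝 (∫ x in Ioc 0 1, (1 : ℝ) ∂μ₁)) := by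
      refine tendsto_integral_filter_of_dominated_convergence (fun _ => (1 : ℝ)) ?_ ?_ (integrable_const _) ?_
      · filter_upwards [self_mem_nhdsWithin] with t ht
        exact (Real.continuous_rpow_const (le_of_lt ht)).aestronglyMeasurable
      · filter_upwards [self_mem_nhdsWithin] with t ht
        refine ae_restrict_of_forall_mem measurableSet_Ioc fun x hx => ?_
        rw [Real.norm_eq_abs, abs_of_nonneg (Real.rpow_nonneg hx.1.le _)]
        exact Real.rpow_le_one hx.1.le hx.2 (le_of_lt ht)
      · refine ae_restrict_of_forall_mem measurableSet_Ioc fun x hx => ?_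
        have hc : ContinuousAt (fun t : ℝ => x ^ t) 0 := Real.continuousAt_const_rpow hx.1.ne'
        have := hc.tendsto
        rw [Real.rpow_zero] at this
        exact this.mono_left nhdsWithin_le_nhds
    rw [setIntegral_const, smul_eq_mul, mul_one] at hlim
    refine hlim.congr' ?_
    filter_upwards [self_mem_nhdsWithin] with t ht
    rw [hreal ht]
    -- `∫ x^t dμ₁ = ∫_{(0,1]} x^t dμ₁`
    rw [← integral_indicator measurableSet_Ioc]
    refine integral_congr_ae ?_
    filter_upwards [hae₁] with x hx
    by_cases hx0 : 0 < x
    · rw [indicator_of_mem (show x ∈ Ioc (0 : ℝ) 1 from ⟨hx0, hx.2⟩)]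
    · have : x = 0 := le_antisymm (not_lt.1 hx0) hx.1
      rw [this, indicator_of_notMem (by simp), Real.zero_rpow (ne_of_gt ht)]

end Literature.MeasureTheory.Integral

end
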